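import Summits.Ventures.GridStability.Lyapunov.NE39LossySplitLinesU3o200LPCertCross
import Summits.Ventures.GridStability.Lyapunov.StructurePreservingLevelBound
import Literature.MathematicalPhysics.PowerSystems.LuriePostnikovSlabSchurForm
import Summits.Ventures.GridStability.Lyapunov.NE39LossySplitLinesLPDual
import HarnessLib

/-!
# «NE39-LOSSY-SPLITU» — an exact Lur'e–Postnikov POSITIVITY certificate on the UNORDERED-LINES split presentation of the
# lossy 39-bus 10-machine Kron model at the window `2·arctan(3/200)` (≈ 1.719°), by lit-6's SCHUR FORM  (certificate file)

Cell `gridfusion` (LADDER-GRIDFUSION G2.c lossy Lur'e tier — the 39-bus rung of memo §4's benchmark ladder); seat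
gridfusion-lit-6 (g10).  The K2A pipeline (`K2ALossySplitLinesLPCert`, p582933) carried to `S = NE39.splitLurieLinesSystem`
(`Models/NE39SplitLurieLines.lean`: lit-6's unordered-lines split Lur'e system of model-4's `NE39.preLossless.toModelRel (1/10) 0` —
New-England 39-bus data Kron-reduced to the 10 machine internal nodes WITH transfer conductances, ASSUMED uniform damping ratio
`λ = 1/10`; states `Fin 10 ⊕ Fin 9`, channels `(Fin 10 × Fin 10) ⊕ (Fin 10 × Fin 10)` = one SINE and one COSINE channel per ORDERED
pair; the 180 channels `p ≠ q` carry multipliers, the 20 diagonal channels have `C_k = 0`), with ONE new device: the certificate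
matrix `−𝓛` (`219 × 219`) is NOT decided monolithically.  Since `C·B = 0` (`NE39LossySplitLines.C_mul_B`) and every `τ_k > 0`,
lit-6's `LuriePostnikovSlabSchurForm` (p585320) reduces `−𝓛 ⪰ 0` to the `19 × 19` SCHUR COMPLEMENT
`−L₁₁ − L₁₂·diag(τ)⁻¹·L₁₂ᵀ ⪰ 0`, decided here by ONE kernel `LDLᵀ` (`schur_ldl₂`) on the formula assembled from TABULATED blocks
(`L11lit`, `L12tab`, data files A/B) whose every entry is re-decided against lit-6's block formulas (`L11lit_eq₂`, `L12lit_eq₂`: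
`L₁₁ = AᵀP + PA + η·1 − Cᵀdiag(τab)C`, `L₁₂ = −PB + (CA)ᵀdiag(λ) + Cᵀdiag(τ(a+b)/2)` entrywise over `ℚ`), and cast to the typed
object (`schur_eq`).

WHAT IS PROVED.  (1) `lpCert : LPSlabCertificate NE39.splitLurieLinesSystem` (lit-6's `LPSlabCertificate.ofSchur`): `P` dyadic
`2^-24` (INDEFINITE diagonal entries), `ε = 1/2097152`, `η = 1/1048576`, `τ > 0` (`1` on the diagonal channels), `λ ≥ 0` (`λ > 0` on 66 channels, 13 of them
with `a < 0` — allowed in this class), OUTER dyadic sector slopes (`2⁻²⁴`) on every ordered pair `p ≠ q`: sine channel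
`a ≤ cos(|δ*| + γ)`, `b ≥ cos(|δ*| − γ)` (narrow) or `b = 1` (the 24 WIDE sine channels, `|δ*_pq| < γ`), cosine channel
`a ≤ −sin(δ* + γ)`, `b ≥ −sin(δ* − γ)`; coercivity `P + Cᵀdiag(λa)C − ε·1 ⪰ 0` by kernel `LDLᵀ` on the tabulated lower matrix
(`lower_ldl₂`, entries re-decided by `lowlit_eq₂`).  (2) `hsecL` — the sector hypothesis on `|ξ − δ*_k| ≤ 2·arctan(3/200)`, all 200
channels (lyap-2's `sector_sin_of_values` / `sector_cos_of_values`, lit-6's wide form `sector_sin_of_values_wide`, the record's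
exact `cd/sd`, `NE39.abs_angle_sub_lt`; kernel tests `sine_testsL₂` / `cosine_testsL₂` / `null_slopesL₂`).
(3) `lpSplitClass_nonempty_NE39` — the positivity class is NON-EMPTY at `2·arctan(3/200)` on `S`.
The ROA sentence, the level and the certified ball are `Bench/NE39LossySplitLinesLPRoa.lean`.

PRODUCER (not trusted; everything re-decided here): lit-6 g10 kit j293727 (`probes/splitgen/splitu_generic.py` JOB_SYSTEM=NE39
JOB_MODE=primal JOB_ACT=pairs JOB_TAUFLOOR=1; output `splitu_NE39_primal_lam1o10_pairs.json` sha16 `8848e3991dd2e7c0`, results[u0 = 3/200,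
klass = lp]): max-margin SDP (CLARABEL, `ν* ≈ 3.70e-06`), dyadic rounding `2^-24`, exact `Fraction` re-check
(`lower − ε·1` min pivot `3.16e-04`, Schur complement min pivot `6.41e-06`); tables by `probes/ne39/gen_ne39_lean.py`.
VALIDATED (floats, kit j292614 / j293727): on this object both split classes have primal margin `ν* > 0` at `u = 1/400 … 3/200` (the
positivity class; the class of record at `… 1/100`) and `ν* < 0` at `1/50`.  THREE COLUMNS.  CERTIFIED (kernel): the identities, the
certificate's defining facts and the class statement for the MODEL; nothing about the 39-bus system or any grid.  MODELLED: as
`Models/NE39SplitLurieLines` / model-4's record.  VALIDATED: the solver lineage and margins above.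
[cite: Khalil2002, §7.1 Example 7.5, §7.1.2 Theorem 7.3; Pai1981, §2.16 (2.63)–(2.64), §3.6.3 (3.43)–(3.45), §4.6 p. 117; HornJohnson2013, Thm 7.7.7; BoydVandenberghe2004, §5.9.4]
-/

noncomputable section

open Real Matrix
open Literature.Computation.Certificates
open Literature.MathematicalPhysics.PowerSystems
open Literature.MathematicalPhysics.PowerSystems.LyapunovFunctionFamily
open Summit.Ventures.GridStability.Models
open Summit.Ventures.GridStability.Bench.WSCC9LossySplitSlab (sector_sin_of_values sector_cos_of_values)
open Summit.Ventures.GridStability.Lyapunov.K2ALossySplitLines (sector_sin_of_values_wide)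
open Summit.Ventures.GridStability.Lyapunov.NE39LossySplitLines (e1 AQ CQ BLQ A_eq B_eq C_eq C_mul_B)

namespace Summit.Ventures.GridStability.Lyapunov.NE39LossySplitLinesU3o200LPCert

/-! ### The Schur complement is positive semidefinite (kernel `LDLᵀ`, file 3 of 3) -/

set_option maxHeartbeats 400000000 in
/-- **The Schur complement `−L₁₁ − L₁₂·diag(τ)⁻¹·L₁₂ᵀ ⪰ 0`** (19 × 19, kernel `LDLᵀ` on the formula over the tables; this one
decision replaces the `219 × 219` fact `−𝓛 ⪰ 0`). -/
theorem schur_ldl₂ : PSD.LDLCert SchF₂ := by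
  decide +kernel

/-! ### The certificate data over `ℝ` and the cast identities -/

/-- `P` (real). -/
def Pr : Matrix (Fin 10 ⊕ Fin 9) (Fin 10 ⊕ Fin 9) ℝ := PL₂.map (Rat.cast : ℚ → ℝ)
/-- `τ` (real). -/
def τr : (Fin 10 × Fin 10) ⊕ (Fin 10 × Fin 10) → ℝ := fun k => (tauL₂ k : ℝ)
/-- `λ` (real). -/
def lamr : (Fin 10 × Fin 10) ⊕ (Fin 10 × Fin 10) → ℝ := fun k => (lamL₂ k : ℝ)
/-- `a` (real). -/
def ar : (Fin 10 × Fin 10) ⊕ (Fin 10 × Fin 10) → ℝ := fun k => (aL₂ k : ℝ)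
/-- `b` (real). -/
def br : (Fin 10 × Fin 10) ⊕ (Fin 10 × Fin 10) → ℝ := fun k => (bL₂ k : ℝ)

/-- `(M·N) ↦ ℝ` (plumbing). -/
private theorem map_mul' {m n o : Type*} [Fintype n] (M : Matrix m n ℚ) (N : Matrix n o ℚ) :
    (M * N).map (Rat.cast : ℚ → ℝ) = M.map (Rat.cast : ℚ → ℝ) * N.map (Rat.cast : ℚ → ℝ) :=
  Matrix.map_mul (f := Rat.castHom ℝ)
/-- `(M + N) ↦ ℝ` (plumbing). -/
private theorem map_add' {m n : Type*} (M N : Matrix m n ℚ) :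
    (M + N).map (Rat.cast : ℚ → ℝ) = M.map (Rat.cast : ℚ → ℝ) + N.map (Rat.cast : ℚ → ℝ) := by
  ext; simp
/-- `(M − N) ↦ ℝ` (plumbing). -/
private theorem map_sub' {m n : Type*} (M N : Matrix m n ℚ) :
    (M - N).map (Rat.cast : ℚ → ℝ) = M.map (Rat.cast : ℚ → ℝ) - N.map (Rat.cast : ℚ → ℝ) := by
  ext; simp
/-- `(−M) ↦ ℝ` (plumbing). -/
private theorem map_neg' {m n : Type*} (M : Matrix m n ℚ) :
    (-M).map (Rat.cast : ℚ → ℝ) = -M.map (Rat.cast : ℚ → ℝ) := by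
  ext; simp
/-- `Mᵀ ↦ ℝ` (plumbing). -/
private theorem map_transpose' {m n : Type*} (M : Matrix m n ℚ) :
    Mᵀ.map (Rat.cast : ℚ → ℝ) = (M.map (Rat.cast : ℚ → ℝ))ᵀ := by
  ext; simp
/-- `diagonal d ↦ ℝ` (plumbing). -/
private theorem map_diagonal' {n : Type*} [DecidableEq n] (d : n → ℚ) :
    (Matrix.diagonal d).map (Rat.cast : ℚ → ℝ) = Matrix.diagonal (fun i => ((d i : ℚ) : ℝ)) :=
  Matrix.diagonal_map (Rat.cast_zero)
/-- `q • 1 ↦ ℝ` (plumbing). -/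
private theorem map_smul_one' {n : Type*} [DecidableEq n] (q : ℚ) :
    (q • (1 : Matrix n n ℚ)).map (Rat.cast : ℚ → ℝ) = ((q : ℚ) : ℝ) • (1 : Matrix n n ℝ) := by
  ext i j; by_cases h : i = j <;> simp [h]

/-- State block identity. -/
private theorem L11_eq : slabL11 NE39.splitLurieLinesSystem Pr (etaLQ : ℝ) τr ar br = LL11Q₂.map (Rat.cast : ℚ → ℝ) := by
  have hd : Matrix.diagonal (fun k => τr k * (ar k * br k))
      = (Matrix.diagonal (fun k => tauL₂ k * (aL₂ k * bL₂ k))).map (Rat.cast : ℚ → ℝ) := by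
    rw [map_diagonal']
    congr 1; funext k; simp [τr, ar, br]
  rw [slabL11, A_eq, C_eq, hd, Pr, LL11Q₂]
  simp only [map_sub', map_add', map_mul', map_transpose', map_smul_one']

/-- Cross block identity. -/
private theorem L12_eq : slabL12 NE39.splitLurieLinesSystem Pr lamr τr ar br = LL12Q₂.map (Rat.cast : ℚ → ℝ) := by
  have hd1 : Matrix.diagonal lamr = (Matrix.diagonal lamL₂).map (Rat.cast : ℚ → ℝ) := by
    rw [map_diagonal']; rfl
  have hd2 : Matrix.diagonal (fun k => τr k * (ar k + br k) / 2)
      = (Matrix.diagonal (fun k => tauL₂ k * (aL₂ k + bL₂ k) / 2)).map (Rat.cast : ℚ → ℝ) := by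
    rw [map_diagonal']
    congr 1; funext k; simp [τr, ar, br]
  rw [slabL12, A_eq, B_eq, C_eq, hd1, hd2, Pr, LL12Q₂]
  simp only [map_add', map_neg', map_mul', map_transpose']

/-- **The Schur complement over `ℝ` is the cast of `SchurQ₂`.** -/
theorem schur_eq : slabSchur NE39.splitLurieLinesSystem Pr (etaLQ : ℝ) lamr τr ar br = SchurQ₂.map (Rat.cast : ℚ → ℝ) := by
  have hd : Matrix.diagonal (fun k => (τr k)⁻¹) = (Matrix.diagonal (fun k => (tauL₂ k)⁻¹)).map (Rat.cast : ℚ → ℝ) := by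
    rw [map_diagonal']
    congr 1; funext k; simp [τr]
  rw [slabSchur, L11_eq, L12_eq, hd, SchurQ₂]
  simp only [map_sub', map_neg', map_mul', map_transpose']

/-- **The lower comparison matrix over `ℝ` is the cast of `lowerLQ₂`.** -/
theorem lower_eq : Pr + NE39.splitLurieLinesSystem.Cᵀ * Matrix.diagonal (fun k => lamr k * ar k) * NE39.splitLurieLinesSystem.C
      - (epsLQ : ℝ) • (1 : Matrix (Fin 10 ⊕ Fin 9) (Fin 10 ⊕ Fin 9) ℝ)
    = lowerLQ₂.map (Rat.cast : ℚ → ℝ) := by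
  have hd : Matrix.diagonal (fun k => lamr k * ar k)
      = (Matrix.diagonal (fun k => lamL₂ k * aL₂ k)).map (Rat.cast : ℚ → ℝ) := by
    rw [map_diagonal']
    congr 1; funext k; simp [lamr, ar]
  rw [C_eq, hd, Pr, lowerLQ₂]
  simp only [map_sub', map_add', map_mul', map_transpose', map_smul_one']

/-- `lowerLQ₂ ⪰ 0` over `ℝ` (from the kernel `LDLᵀ` on the table, reindexed). -/
private theorem lower_psd : (lowerLQ₂.map (Rat.cast : ℚ → ℝ)).PosSemidef := by
  rw [lowerLQ_eq_F₂]
  exact (lower_ldl₂.posSemidef (R := ℝ)).submatrix e1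

/-- **The Schur complement is positive semidefinite** over `ℝ`. -/
theorem schur_psd : (slabSchur NE39.splitLurieLinesSystem Pr (etaLQ : ℝ) lamr τr ar br).PosSemidef := by
  rw [schur_eq, SchurQ_eq_F₂]
  exact (schur_ldl₂.posSemidef (R := ℝ)).submatrix e1

/-! ### The certificate -/

/-- **An exact Lur'e–Postnikov POSITIVITY certificate on the unordered-lines split presentation of the lossy 39-bus
model at `2·arctan(3/200)`**, assembled by lit-6's Schur-form constructor (`C·B = 0`, `τ > 0`, Schur complement `⪰ 0`).
[cite: Khalil2002, §7.1.2 Theorem 7.3 with §7.1 Example 7.5; Pai1981, §2.16 (2.63)–(2.64), §3.6.3 (3.43)–(3.45); HornJohnson2013, Thm 7.7.7] -/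
def lpCert : LPSlabCertificate NE39.splitLurieLinesSystem :=
  LPSlabCertificate.ofSchur NE39.splitLurieLinesSystem C_mul_B Pr (epsLQ : ℝ) (etaLQ : ℝ) τr lamr ar br
    (by
      show (PL₂.map (Rat.cast : ℚ → ℝ))ᵀ = PL₂.map (Rat.cast : ℚ → ℝ)
      rw [← map_transpose', PL_transpose₂])
    (by exact_mod_cast (by norm_num [epsLQ] : (0 : ℚ) < epsLQ)) (by exact_mod_cast (by norm_num [etaLQ] : (0 : ℚ) < etaLQ))
    (by rw [lower_eq]; exact lower_psd)
    (fun k => by unfold τr; exact_mod_cast (multL₂ k).1)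
    (fun k => by unfold lamr; exact_mod_cast (multL₂ k).2)
    schur_psd

/-- The certificate's slopes are the literals (definitional). -/
theorem lpCert_a_b (k : (Fin 10 × Fin 10) ⊕ (Fin 10 × Fin 10)) : lpCert.a k = ((aL₂ k : ℚ) : ℝ) ∧ lpCert.b k = ((bL₂ k : ℚ) : ℝ) := ⟨rfl, rfl⟩

/-- The certificate's `ε` is the literal (definitional). -/
theorem lpCert_ε : lpCert.ε = ((epsLQ : ℚ) : ℝ) := rfl

/-- The certificate's `P`, `λ`, `a`, `b` (definitional; for the Bench file). -/
theorem lpCert_P_lam : lpCert.P = Pr ∧ lpCert.lam = lamr ∧ lpCert.a = ar ∧ lpCert.b = br := ⟨rfl, rfl, rfl, rfl⟩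

/-! ### The sector hypothesis at `γ = 2·arctan(3/200)` -/

/-- `cos γ = 39991/40009` and `sin γ = 1200/40009` for `γ = 2·arctan(3/200)`. -/
theorem cos_sin_γL : Real.cos (2 * Real.arctan (3 / 200 : ℝ)) = ((39991/40009 : ℚ) : ℝ) ∧
    Real.sin (2 * Real.arctan (3 / 200 : ℝ)) = ((1200/40009 : ℚ) : ℝ) := by
  rw [Lyapunov.StructurePreserving.cos_two_mul_arctan, Lyapunov.StructurePreserving.sin_two_mul_arctan]
  constructor <;> push_cast <;> norm_num

/-- `0 ≤ γ < π/2`. -/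
theorem γL_range : 0 ≤ 2 * Real.arctan (3 / 200 : ℝ) ∧ 2 * Real.arctan (3 / 200 : ℝ) < π / 2 :=
  ⟨Lyapunov.StructurePreserving.two_mul_arctan_nonneg (by norm_num),
    Lyapunov.StructurePreserving.two_mul_arctan_lt_pi_div_two (by norm_num)⟩

/-- DIAGONAL channels (`p = q`, `C_k = 0`) carry the trivial sector `[−1, 1]` (kernel). -/
theorem null_slopesL₂ : ∀ p : Fin 10,
    aL₂ (Sum.inl (p, p)) = -1 ∧ bL₂ (Sum.inl (p, p)) = 1 ∧ aL₂ (Sum.inr (p, p)) = -1 ∧ bL₂ (Sum.inr (p, p)) = 1 := by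
  decide +kernel

set_option maxHeartbeats 4000000 in
/-- **Sine-channel tests at `(cos γ, sin γ) = (39991, 1200)/40009`** for every ordered pair `p ≠ q`: EITHER
the narrow form `sin γ ≤ |sd| ∧ a ≤ cd·cos γ − |sd|·sin γ ∧ cd·cos γ + |sd|·sin γ ≤ b` OR the wide form
`a ≤ cd·cos γ − |sd|·sin γ ∧ 1 ≤ b` (kernel, outer dyadic slopes). -/
theorem sine_testsL₂ : ∀ p q : Fin 10, p ≠ q →
    ((1200/40009 : ℚ) ≤ |NE39.preLossless.sd p q| ∧
      aL₂ (Sum.inl (p, q)) ≤ NE39.preLossless.cd p q * (39991/40009) - |NE39.preLossless.sd p q| * (1200/40009) ∧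
      NE39.preLossless.cd p q * (39991/40009) + |NE39.preLossless.sd p q| * (1200/40009) ≤ bL₂ (Sum.inl (p, q))) ∨
    (aL₂ (Sum.inl (p, q)) ≤ NE39.preLossless.cd p q * (39991/40009) - |NE39.preLossless.sd p q| * (1200/40009) ∧
      1 ≤ bL₂ (Sum.inl (p, q))) := by
  decide +kernel

set_option maxHeartbeats 4000000 in
/-- **Cosine-channel tests** for every ordered pair `p ≠ q`: `sin γ ≤ cd`, `a ≤ −(sd·cos γ + cd·sin γ)`,
`−(sd·cos γ − cd·sin γ) ≤ b` (kernel). -/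
theorem cosine_testsL₂ : ∀ p q : Fin 10, p ≠ q →
    (1200/40009 : ℚ) ≤ NE39.preLossless.cd p q ∧
      aL₂ (Sum.inr (p, q)) ≤ -(NE39.preLossless.sd p q * (39991/40009) + NE39.preLossless.cd p q * (1200/40009)) ∧
      -(NE39.preLossless.sd p q * (39991/40009) - NE39.preLossless.cd p q * (1200/40009)) ≤ bL₂ (Sum.inr (p, q)) := by
  decide +kernel

/-- **`hsecL`**: on the window `|ξ − δ*_k| ≤ 2·arctan(3/200)` every channel's cosine lies in `[a_k, b_k]`. -/
theorem hsecL : ∀ k ξ, |ξ - NE39.splitLurieLinesSystem.δs k| ≤ 2 * Real.arctan (3 / 200 : ℝ) →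
    lpCert.a k ≤ Real.cos ξ ∧ Real.cos ξ ≤ lpCert.b k := by
  rintro (⟨p, q⟩ | ⟨p, q⟩) ξ hξ
  · rw [(lpCert_a_b _).1, (lpCert_a_b _).2]
    change |ξ - (NE39.preLossless.angleOf p - NE39.preLossless.angleOf q)| ≤ _ at hξ
    by_cases hpq : p = q
    · subst hpq
      obtain ⟨h1, h2, -, -⟩ := null_slopesL₂ p
      rw [h1, h2]; push_cast
      exact ⟨Real.neg_one_le_cos ξ, Real.cos_le_one ξ⟩
    · rcases sine_testsL₂ p q hpq with ⟨t1, t2, t3⟩ | ⟨t2, t3⟩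
      · refine sector_sin_of_values (NE39.abs_angle_sub_lt p q) γL_range.1 γL_range.2
          (NE39.sin_angleOf_sub p q) (NE39.cos_angleOf_sub p q) cos_sin_γL.1 cos_sin_γL.2 ?_ ?_ ?_ ξ hξ
        · rw [← Rat.cast_abs]; exact_mod_cast t1
        · rw [← Rat.cast_abs]; exact_mod_cast t2
        · rw [← Rat.cast_abs]; exact_mod_cast t3
      · refine sector_sin_of_values_wide (NE39.abs_angle_sub_lt p q) γL_range.1 γL_range.2
          (NE39.sin_angleOf_sub p q) (NE39.cos_angleOf_sub p q) cos_sin_γL.1 cos_sin_γL.2 ?_ ?_ ξ hξ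
        · rw [← Rat.cast_abs]; exact_mod_cast t2
        · exact_mod_cast t3
  · rw [(lpCert_a_b _).1, (lpCert_a_b _).2]
    change |ξ - (NE39.preLossless.angleOf p - NE39.preLossless.angleOf q + π / 2)| ≤ _ at hξ
    by_cases hpq : p = q
    · subst hpq
      obtain ⟨-, -, h1, h2⟩ := null_slopesL₂ p
      rw [h1, h2]; push_cast
      exact ⟨Real.neg_one_le_cos ξ, Real.cos_le_one ξ⟩
    · obtain ⟨t1, t2, t3⟩ := cosine_testsL₂ p q hpq
      refine sector_cos_of_values (NE39.abs_angle_sub_lt p q) γL_range.2.le (NE39.sin_angleOf_sub p q)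
        (NE39.cos_angleOf_sub p q) cos_sin_γL.1 cos_sin_γL.2 ?_ ?_ ?_ ξ hξ
      · exact_mod_cast t1
      · exact_mod_cast t2
      · exact_mod_cast t3

/-! ### THE CLASS STATEMENT -/

/-- **The Lur'e–Postnikov positivity class on the unordered-lines split presentation of the lossy 39-bus model is
NON-EMPTY at `2·arctan(3/200)`** (≈ 1.719°). -/
theorem lpSplitClass_nonempty_NE39 :
    ∃ Λ : LPSlabCertificate NE39.splitLurieLinesSystem,
      ∀ k ξ, |ξ - NE39.splitLurieLinesSystem.δs k| ≤ 2 * Real.arctan (3 / 200 : ℝ) → Λ.a k ≤ Real.cos ξ ∧ Real.cos ξ ≤ Λ.b k :=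
  ⟨lpCert, hsecL⟩


/-! ### THE TIGHT BRACKET (with the ceiling file `NE39LossySplitLinesLPDual`, γ₀ = 2·arctan(13/800) ≈ 1.862°) -/

/-- This file's window lies strictly below the ceiling: `2·arctan(3/200) < γ₀ = 2·arctan(13/800)`. -/
theorem γ_lt_γ₀ : 2 * Real.arctan (3 / 200 : ℝ) < NE39LossySplitLinesLPDual.γ₀ := by
  rw [NE39LossySplitLinesLPDual.γ₀_eq]
  have h : (3 / 200 : ℝ) < 13 / 800 := by norm_num
  have := Real.arctan_strictMono h
  linarith

/-- **THE TIGHT BRACKET on the lossy 39-bus object**: the split positivity class is NON-EMPTY at `2·arctan(3/200)`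
(≈ 1.719°, this file's `lpCert`) and BOTH split classes (positivity, and the class of record) are EMPTY at every window
`≥ γ₀ = 2·arctan(13/800)` (≈ 1.862°, lit-6's rank-19 Gram-factored LP dual witness, `NE39LossySplitLinesLPDual`). -/
theorem splitClassCeiling_bracket_NE39_tight :
    (∃ Λ : LPSlabCertificate NE39.splitLurieLinesSystem,
      ∀ k ξ, |ξ - NE39.splitLurieLinesSystem.δs k| ≤ 2 * Real.arctan (3 / 200 : ℝ) → Λ.a k ≤ Real.cos ξ ∧ Real.cos ξ ≤ Λ.b k) ∧
    (∀ γ' : ℝ, NE39LossySplitLinesLPDual.γ₀ ≤ γ' → ¬ ∃ Λ : LPSlabCertificate NE39.splitLurieLinesSystem,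
      ∀ k ξ, |ξ - NE39.splitLurieLinesSystem.δs k| ≤ γ' → Λ.a k ≤ Real.cos ξ ∧ Real.cos ξ ≤ Λ.b k) ∧
    ∀ γ' : ℝ, NE39LossySplitLinesLPDual.γ₀ ≤ γ' → ¬ ∃ Λ : SlabCertificate NE39.splitLurieLinesSystem,
      ∀ k ξ, |ξ - NE39.splitLurieLinesSystem.δs k| ≤ γ' → Λ.a k ≤ Real.cos ξ ∧ Real.cos ξ ≤ Λ.b k :=
  ⟨lpSplitClass_nonempty_NE39, NE39LossySplitLinesLPDual.lpSplitClass_empty_NE39,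
    NE39LossySplitLinesLPDual.splitSlabClass_empty_NE39⟩

end Summit.Ventures.GridStability.Lyapunov.NE39LossySplitLinesU3o200LPCert

end
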